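import Mathlib
import Literature.AlgebraicGeometry.Resolution.AdaptedChainRecursion
import Literature.AlgebraicGeometry.Resolution.MonicTransport
import HarnessLib

/-!
# The adapted coordinate after a chart step at `τ = 1` (monic transport and re-adaptation)

Topic: `Literature/AlgebraicGeometry/Resolution`. V. Cossart, O. Piltant, *Resolution of singularities
of threefolds in positive characteristic II*, J. Algebra 321 (2009), §4 p. 11, (10)–(11)
[cite: CossartPiltant2008, Prop. 4.4]; V. Cossart, U. Jannsen, S. Saito, *Desingularization: invariants
and strategy*, Lecture Notes in Math. 2270 (2020), (12.1), Lemma 12.1 (2), Claim 13.8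
[cite: CossartJannsenSaito2020, Lemma 12.1].

OURS (glue for brick B3 `ShearLiftRecursion.exists_shearLift_coordinates` of the `τ = 1` endgame).
For a regular system of parameters `c = (y, u₁, u₂)` of a three-dimensional regular local ring and
`J ⊆ 𝔪^μ`: (1) adaptedness `cl_μ(J) ⊆ k·Y^μ` is equivalent to `g ≡ f_g y^μ mod 𝔪^{μ+1}` for all
`g ∈ J`, hence depends on `y` only (`forall_initialForms_of_eq_zero`); (2) the shape
`in_μ(g) = a (X₀ + b X₁ + c X₂)^μ` moves to `a (X₀ + (b − r̄₁) X₁ + (c − r̄₂) X₂)^μ` under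
`y ↦ y + r₁ u₁ + r₂ u₂` (`ReAdaptation.IsInForm.shiftZ_linear`), so monic elements survive and, from
`τ = 1` and a monic element (`ReAdaptation.exists_linShape_of_hironakaTauAt_eq_one`), an ADAPTED
`y″ = y + b u₁ + c u₂` exists — with `c = 0`, i.e. `(y″, u₁) = (y, u₁)`, as soon as
`J ⊆ (y, u₁)^μ` (a binary form has no `U₂^μ` term): `exists_adapted_coordinate_of_hasMonic`;
(3) a monic element passes to the next level of a chart step
(`MonicTransport.hasMonic_of_monic_of_chart`): `hasMonic_of_chart_step`. This answers where the
directrix at the next level gets its nonzero `Y′`-component (it is never in `span(U′, W′)`).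
No summit statement is proved.
-/

noncomputable section

open IsLocalRing MvPolynomial

namespace Literature.AlgebraicGeometry.Resolution

universe u

/-! ## Adaptedness of `(y, u₁, u₂)` only depends on `y`: `cl_μ(J) ⊆ k·Y^μ ⟺ ∀ g ∈ J, g ≡ f y^μ mod 𝔪^{μ+1}` -/

section Adapted

variable {R : Type u} [CommRing R] [IsRegularLocalRing R] (c : Fin 3 → R)
  (hgen : Ideal.span {c 0, c 1, c 2} = maximalIdeal R) (hdim : ringKrullDim R = 3)
  {J : Ideal R} {μ : ℕ}

include hgen hdim in
/-- **Adapted ⇒ every `g ∈ J` is `f y^μ` modulo `𝔪^{μ+1}`.** If every degree-`μ` initial form of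
`J ⊆ 𝔪^μ` w.r.t. `c = (y, u₁, u₂)` is a multiple of `Y^μ`, then each `g ∈ J` satisfies
`g − f y^μ ∈ 𝔪^{μ+1}` for some `f ∈ R` (lift `in_μ(g) = ā Y^μ` to `F = a Y^μ + G`, `G` with
coefficients in `𝔪`). [cite: CossartJannsenSaito2020, (12.1)] [cite: CossartPiltant2008, (10)] -/
theorem exists_sub_mul_pow_mem_of_forall_initialForms (hJμ : J ≤ maximalIdeal R ^ μ)
    (had : ∀ G ∈ initialForms c J μ, ∃ a : ResidueField R, G = C a * X 0 ^ μ) {g : R} (hgJ : g ∈ J) :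
    ∃ f : R, g - f * c 0 ^ μ ∈ maximalIdeal R ^ (μ + 1) := by
  classical
  have hgenr := span_range_eq_of_span_triple c hgen
  have h1 : ∀ i, 0 < (fun _ : Fin 3 => (1 : ℕ)) i := fun _ => Nat.one_pos
  obtain ⟨a, ha⟩ := had _ ((mem_initialForms_iff_exists_inForm c hgen hdim hJμ _).mpr ⟨g, hgJ, rfl⟩)
  have hgμ : g ∈ weightedIdealW c (fun _ => 1) μ := by
    rw [weightedIdealW_one_eq_pow c hgenr]; exact hJμ hgJ
  obtain ⟨F, hF, hFmap, hFrem⟩ := isInForm_inForm c hgen hdim h1 hgμ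
  rw [ha] at hFmap
  set f : R := F.coeff (Finsupp.single 0 μ) with hf
  have hres : residue R f = a := by
    have := congrArg (MvPolynomial.coeff (Finsupp.single (0 : Fin 3) μ)) hFmap
    rwa [coeff_map, coeff_C_mul, coeff_X_pow, if_pos rfl, mul_one] at this
  have hmono : (C f * X 0 ^ μ : MvPolynomial (Fin 3) R).IsWeightedHomogeneous (fun _ => (1 : ℕ)) μ := by
    rw [isWeightedHomogeneous_one_iff]
    have := (isHomogeneous_C (Fin 3) f).mul (isHomogeneous_X_pow (0 : Fin 3) μ)
    rwa [zero_add] at this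
  set G : MvPolynomial (Fin 3) R := F - C f * X 0 ^ μ with hG
  have hGhom : G.IsWeightedHomogeneous (fun _ => (1 : ℕ)) μ := isWeightedHomogeneous_sub hF hmono
  have hGcoeff : ∀ m, G.coeff m ∈ maximalIdeal R := by
    rw [← map_residue_eq_zero_iff, hG, map_sub, hFmap, map_mul, map_C, map_pow, map_X, hres, sub_self]
  have hGeval : eval c G ∈ weightedIdealW c (fun _ => 1) (μ + 1) :=
    eval_mem_succ_of_coeff_mem c hgenr h1 hGhom hGcoeff
  refine ⟨f, ?_⟩
  have : g - f * c 0 ^ μ = (g - eval c F) + eval c G := by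
    rw [hG, map_sub, map_mul, eval_C, map_pow, eval_X]; ring
  rw [this, ← weightedIdealW_one_eq_pow c hgenr]
  exact Ideal.add_mem _ hFrem hGeval

include hgen hdim in
/-- **Every `g ∈ J` is `f y^μ` modulo `𝔪^{μ+1}` ⇒ adapted**: then every degree-`μ` initial form of
`J ⊆ 𝔪^μ` w.r.t. `c` is `f̄ Y^μ`. [cite: CossartJannsenSaito2020, (12.1)] [cite: CossartPiltant2008, (10)] -/
theorem forall_initialForms_of_forall_sub_mul_pow_mem (hJμ : J ≤ maximalIdeal R ^ μ)
    (h : ∀ g ∈ J, ∃ f : R, g - f * c 0 ^ μ ∈ maximalIdeal R ^ (μ + 1)) :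
    ∀ G ∈ initialForms c J μ, ∃ a : ResidueField R, G = C a * X 0 ^ μ := by
  classical
  have hgenr := span_range_eq_of_span_triple c hgen
  have h1 : ∀ i, 0 < (fun _ : Fin 3 => (1 : ℕ)) i := fun _ => Nat.one_pos
  intro G hG
  obtain ⟨g, hgJ, rfl⟩ := (mem_initialForms_iff_exists_inForm c hgen hdim hJμ G).mp hG
  obtain ⟨f, hf⟩ := h g hgJ
  refine ⟨residue R f, ?_⟩
  have hin : IsInForm c (fun _ => 1) μ g (C (residue R f) * X 0 ^ μ) := by
    refine ⟨C f * X 0 ^ μ, ?_, by rw [map_mul, map_C, map_pow, map_X], ?_⟩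
    · rw [isWeightedHomogeneous_one_iff]
      have := (isHomogeneous_C (Fin 3) f).mul (isHomogeneous_X_pow (0 : Fin 3) μ)
      rwa [zero_add] at this
    · rw [weightedIdealW_one_eq_pow c hgenr, map_mul, eval_C, map_pow, eval_X]
      exact hf
  exact (hin.eq_inForm c hgen hdim h1).symm

omit [IsRegularLocalRing R] in
/-- If `g ∉ 𝔪^{μ+1}` and `g − f y^μ ∈ 𝔪^{μ+1}` with `y ∈ 𝔪`, then `f` is a unit. [folklore] -/
private theorem isUnit_of_sub_mul_pow_mem [IsLocalRing R] {y g f : R} (hy : y ∈ maximalIdeal R)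
    (hg : g ∉ maximalIdeal R ^ (μ + 1)) (hgf : g - f * y ^ μ ∈ maximalIdeal R ^ (μ + 1)) : IsUnit f := by
  by_contra hf
  apply hg
  have hfm : f ∈ maximalIdeal R := (mem_maximalIdeal _).mpr hf
  have : f * y ^ μ ∈ maximalIdeal R ^ (μ + 1) := by
    rw [pow_succ']; exact Ideal.mul_mem_mul hfm (Ideal.pow_mem_pow hy μ)
  simpa using Ideal.add_mem _ hgf this

include hdim in
/-- **Adaptedness depends only on `y`**: if `c = (y, u₁, u₂)` and `c′ = (y, u′₁, u′₂)` are regular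
systems of parameters with the same first member and `cl_μ(J) ⊆ k·Y^μ` w.r.t. `c`, then also w.r.t.
`c′`. [cite: CossartJannsenSaito2020, (12.1)] -/
theorem forall_initialForms_of_eq_zero (hJμ : J ≤ maximalIdeal R ^ μ) (c' : Fin 3 → R)
    (hgen : Ideal.span {c 0, c 1, c 2} = maximalIdeal R)
    (hgen' : Ideal.span {c' 0, c' 1, c' 2} = maximalIdeal R) (h0 : c' 0 = c 0)
    (had : ∀ G ∈ initialForms c J μ, ∃ a : ResidueField R, G = C a * X 0 ^ μ) :
    ∀ G ∈ initialForms c' J μ, ∃ a : ResidueField R, G = C a * X 0 ^ μ := by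
  refine forall_initialForms_of_forall_sub_mul_pow_mem c' hgen' hdim hJμ fun g hg => ?_
  rw [h0]
  exact exists_sub_mul_pow_mem_of_forall_initialForms c hgen hdim hJμ had hg

end Adapted

/-! ## Shape transport under `y ↦ y + r₁ u₁ + r₂ u₂`; the adapted coordinate from `τ = 1` and a monic element -/

section Shape

variable {R : Type u} [CommRing R] [IsRegularLocalRing R] (c : Fin 3 → R)
  (hgen : Ideal.span {c 0, c 1, c 2} = maximalIdeal R) (hdim : ringKrullDim R = 3)
  {J : Ideal R} {μ : ℕ}

omit [IsRegularLocalRing R] in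
/-- `(y + t, u₁, u₂) = (y, u₁, u₂)` as ideals for `t ∈ (u₁, u₂)`. [folklore] -/
private theorem span_triple_shiftZ_eq_maximalIdeal [IsLocalRing R]
    (hgen : Ideal.span {c 0, c 1, c 2} = maximalIdeal R) {t : R}
    (ht : t ∈ Ideal.span ({c 1, c 2} : Set R)) :
    Ideal.span {shiftZ c t 0, shiftZ c t 1, shiftZ c t 2} = maximalIdeal R := by
  rw [← hgen]
  simp only [shiftZ_zero, shiftZ_one, shiftZ_two]
  have hsub : Ideal.span ({c 1, c 2} : Set R) ≤ Ideal.span {c 0, c 1, c 2} :=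
    Ideal.span_mono (by intro x hx; simp only [Set.mem_insert_iff, Set.mem_singleton_iff] at hx ⊢; tauto)
  have hsub' : Ideal.span ({c 1, c 2} : Set R) ≤ Ideal.span {c 0 + t, c 1, c 2} :=
    Ideal.span_mono (by intro x hx; simp only [Set.mem_insert_iff, Set.mem_singleton_iff] at hx ⊢; tauto)
  apply le_antisymm
  · rw [Ideal.span_le]
    rintro x (rfl | rfl | rfl)
    · exact Ideal.add_mem _ (Ideal.subset_span (by simp)) (hsub (by exact ht))
    · exact Ideal.subset_span (by simp)
    · exact Ideal.subset_span (by simp)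
  · rw [Ideal.span_le]
    rintro x (rfl | rfl | rfl)
    · have h0 : c 0 + t ∈ Ideal.span ({c 0 + t, c 1, c 2} : Set R) := Ideal.subset_span (by simp)
      have h := Ideal.sub_mem _ h0 (hsub' ht)
      rwa [add_sub_cancel_right] at h
    · exact Ideal.subset_span (by simp)
    · exact Ideal.subset_span (by simp)

omit [IsRegularLocalRing R] in
/-- `r₁ u₁ + r₂ u₂ ∈ (u₁, u₂)`. [folklore] -/
private theorem linear_mem_span_pair (r₁ r₂ : R) : r₁ * c 1 + r₂ * c 2 ∈ Ideal.span ({c 1, c 2} : Set R) :=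
  Ideal.add_mem _ (Ideal.mul_mem_left _ _ (Ideal.subset_span (by simp)))
    (Ideal.mul_mem_left _ _ (Ideal.subset_span (by simp)))

include hgen hdim in
/-- **Shape transport under the linear shift.** If `in_μ(g) = a (X₀ + b X₁ + c X₂)^μ` w.r.t.
`c = (y, u₁, u₂)` (`g ∈ 𝔪^μ`), then w.r.t. `(y + r₁ u₁ + r₂ u₂, u₁, u₂)` one has
`in_μ(g) = a (X₀ + (b − r̄₁) X₁ + (c − r̄₂) X₂)^μ`. [cite: CossartPiltant2008, §4 p. 11] -/
theorem inForm_shiftZ_eq_of_inForm_eq {g : R} (hgμ' : g ∈ maximalIdeal R ^ μ) (r₁ r₂ : R)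
    {a b cc : ResidueField R}
    (h : inForm c (fun _ => 1) μ g = C a * (X 0 + C b * X 1 + C cc * X 2) ^ μ) :
    inForm (shiftZ c (r₁ * c 1 + r₂ * c 2)) (fun _ => 1) μ g =
      C a * (X 0 + C (b - residue R r₁) * X 1 + C (cc - residue R r₂) * X 2) ^ μ := by
  have hgenr := span_range_eq_of_span_triple c hgen
  have h1 : ∀ i, 0 < (fun _ : Fin 3 => (1 : ℕ)) i := fun _ => Nat.one_pos
  have hgμ : g ∈ weightedIdealW c (fun _ => 1) μ := by rw [weightedIdealW_one_eq_pow c hgenr]; exact hgμ'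
  have hin := isInForm_inForm c hgen hdim h1 hgμ
  rw [h] at hin
  have hsh := hin.shiftZ_linear c hgenr r₁ r₂
  rw [map_mul, bind₁_C_right, map_pow, bind₁_lsub_linear] at hsh
  have hgen' := span_triple_shiftZ_eq_maximalIdeal c hgen (linear_mem_span_pair c r₁ r₂)
  exact (hsh.eq_inForm _ hgen' hdim h1).symm

include hgen hdim in
/-- **`J ⊆ (y, u₁)^μ` forces the shape to avoid `U₂`**: if all `in_μ(g)` are multiples of
`(X₀ + b X₁ + c X₂)^μ`, some `in_μ(g)` has a `Y^μ` term, `0 < μ` and `J ⊆ (y, u₁)^μ`, then `c = 0`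
(a form in `Y, U₁` has no `U₂^μ` term). [folklore] -/
private theorem linShape_snd_eq_zero (hμ : 0 < μ) {b cc : ResidueField R} (hshape : LinShape c J μ b cc)
    (hmon : HasMonic c J μ) (hJP : J ≤ Ideal.span {c 0, c 1} ^ μ) : cc = 0 := by
  classical
  have hgenr := span_range_eq_of_span_triple c hgen
  have h1 : ∀ i, 0 < (fun _ : Fin 3 => (1 : ℕ)) i := fun _ => Nat.one_pos
  obtain ⟨g, hgJ, hg⟩ := hmon
  obtain ⟨a, ha⟩ := hshape g hgJ
  have ha0 : a ≠ 0 := by rwa [LinShape.coeff_single_zero c ha] at hg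
  -- `g = F₂(y, u₁)` with `F₂` a binary form of degree `μ`
  set x : Fin 2 → R := ![c 0, c 1] with hx
  have hxr : Ideal.span (Set.range x) = Ideal.span {c 0, c 1} := by
    simp only [hx, Matrix.range_cons, Matrix.range_empty, Set.union_empty, Set.singleton_union]
  obtain ⟨F₂, hF₂, hF₂g⟩ := exists_isHomogeneous_of_mem_span_pow x μ (by rw [hxr]; exact hJP hgJ)
  set ι : Fin 2 → Fin 3 := ![0, 1] with hι
  set F : MvPolynomial (Fin 3) R := rename ι F₂ with hF
  have hFhom : F.IsHomogeneous μ := MvPolynomial.IsHomogeneous.rename_isHomogeneous hF₂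
  have hcι : c ∘ ι = x := by ext i; fin_cases i <;> simp [hι, hx]
  have hFg : eval c F = g := by rw [hF, eval_rename, hcι, hF₂g]
  have hle : Ideal.span {c 0, c 1} ≤ maximalIdeal R := by
    rw [← hgen, Ideal.span_le]
    rintro r (rfl | rfl)
    · exact Ideal.subset_span (by simp)
    · exact Ideal.subset_span (by simp)
  have hgm : g ∈ maximalIdeal R ^ μ := Ideal.pow_right_mono hle μ (hJP hgJ)
  have hin : IsInForm c (fun _ => 1) μ g (MvPolynomial.map (residue R) F) :=
    ⟨F, (isWeightedHomogeneous_one_iff _ _).mpr hFhom, rfl, by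
      rw [hFg, sub_self]; exact Ideal.zero_mem _⟩
  have heq := hin.eq_inForm c hgen hdim h1
  rw [ha] at heq
  -- compare the `U₂^μ` coefficients
  have hcoef := congrArg (MvPolynomial.coeff (Finsupp.single (2 : Fin 3) μ)) heq
  rw [coeff_map, coeff_C_mul, coeff_linearPow_single_two, hF, coeff_rename_eq_zero, map_zero] at hcoef
  · have : cc ^ μ = 0 := by
      rcases mul_eq_zero.mp hcoef.symm with h | h
      · exact absurd h ha0
      · exact h
    exact (pow_eq_zero_iff (Nat.pos_iff_ne_zero.mp hμ)).mp this
  · intro m hm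
    exfalso
    have h2 : (2 : Fin 3) ∉ Set.range ι := by
      rintro ⟨i, hi⟩; fin_cases i <;> simp [hι] at hi
    have := Finsupp.mapDomain_notin_range m 2 h2
    rw [hm, Finsupp.single_eq_same] at this
    exact (Nat.pos_iff_ne_zero.mp hμ) this

include hgen hdim in
/-- **The adapted coordinate from `τ = 1` and a monic element.** If `J ⊆ 𝔪^μ` (`0 < μ`) has
`τ = 1` w.r.t. `c = (y, u₁, u₂)` and some `in_μ(g)` has a `Y^μ` term, then for suitable
`b, c' ∈ R` every degree-`μ` initial form w.r.t. `(y + b u₁ + c' u₂, u₁, u₂)` is a multiple of `Y^μ`;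
and `c' = 0` may be taken when `J ⊆ (y, u₁)^μ`. [cite: CossartPiltant2008, §4 p. 11]
[cite: CossartJannsenSaito2020, (12.1)] -/
theorem exists_adapted_shiftZ_of_hasMonic (hJμ : J ≤ maximalIdeal R ^ μ) (hμ : 0 < μ)
    (hτ : hironakaTauAt c J μ = 1) (hmon : HasMonic c J μ) :
    ∃ b cc : R, (∀ G ∈ initialForms (shiftZ c (b * c 1 + cc * c 2)) J μ,
        ∃ a : ResidueField R, G = C a * X 0 ^ μ) ∧
      (J ≤ Ideal.span {c 0, c 1} ^ μ → cc = 0) := by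
  classical
  obtain ⟨bb, ccb, hshape⟩ := exists_linShape_of_hironakaTauAt_eq_one c hgen hdim hJμ hμ hτ hmon
  obtain ⟨b, hb⟩ := residue_surjective bb
  -- the second lift: `0` when `J ⊆ (y, u₁)^μ` (then `ccb = 0`), any lift otherwise
  obtain ⟨cc, hcc, hcc0⟩ : ∃ cc : R, residue R cc = ccb ∧ (J ≤ Ideal.span {c 0, c 1} ^ μ → cc = 0) := by
    by_cases hJP : J ≤ Ideal.span {c 0, c 1} ^ μ
    · exact ⟨0, by rw [map_zero, linShape_snd_eq_zero c hgen hdim hμ hshape hmon hJP], fun _ => rfl⟩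
    · obtain ⟨cc, hcc⟩ := residue_surjective ccb
      exact ⟨cc, hcc, fun h => absurd h hJP⟩
  refine ⟨b, cc, fun G hG => ?_, hcc0⟩
  have hgen' := span_triple_shiftZ_eq_maximalIdeal c hgen (linear_mem_span_pair c b cc)
  obtain ⟨g, hgJ, rfl⟩ := (mem_initialForms_iff_exists_inForm _ hgen' hdim hJμ G).mp hG
  obtain ⟨a, ha⟩ := hshape g hgJ
  refine ⟨a, ?_⟩
  rw [inForm_shiftZ_eq_of_inForm_eq c hgen hdim (hJμ hgJ) b cc ha, hb, hcc, sub_self, sub_self, C_0,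
    zero_mul, zero_mul, add_zero, add_zero]

include hgen hdim in
/-- **Monic elements survive `y ↦ y + r₁ u₁ + r₂ u₂`** (at `τ = 1`): the `Y^μ`-coefficient of
`a (X₀ + b X₁ + c X₂)^μ` is `a`, before and after the shift. [cite: CossartPiltant2008, §4 p. 11] -/
theorem hasMonic_shiftZ_linear (hJμ : J ≤ maximalIdeal R ^ μ) (hμ : 0 < μ)
    (hτ : hironakaTauAt c J μ = 1) (hmon : HasMonic c J μ) (r₁ r₂ : R) :
    HasMonic (shiftZ c (r₁ * c 1 + r₂ * c 2)) J μ := by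
  classical
  obtain ⟨bb, ccb, hshape⟩ := exists_linShape_of_hironakaTauAt_eq_one c hgen hdim hJμ hμ hτ hmon
  obtain ⟨g, hgJ, hg⟩ := hmon
  obtain ⟨a, ha⟩ := hshape g hgJ
  have ha0 : a ≠ 0 := by rwa [LinShape.coeff_single_zero c ha] at hg
  refine ⟨g, hgJ, ?_⟩
  rw [inForm_shiftZ_eq_of_inForm_eq c hgen hdim (hJμ hgJ) r₁ r₂ ha, coeff_C_mul,
    coeff_linearPow_single_zero, mul_one]
  exact ha0

end Shape

/-! ## The adapted coordinate at the next level of a chart step -/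

section ChartStep

variable {R : Type u} [CommRing R]

/-- `(y, u, w − s u) = (y, u, w)` as ideals. [folklore] -/
private theorem span_triple_sub_mul_snd_eq (y u w s : R) :
    Ideal.span ({y, u, w - s * u} : Set R) = Ideal.span {y, u, w} := by
  apply le_antisymm
  · rw [Ideal.span_le]
    rintro x (rfl | rfl | rfl)
    · exact Ideal.subset_span (by simp)
    · exact Ideal.subset_span (by simp)
    · exact Ideal.sub_mem _ (Ideal.subset_span (by simp))
        (Ideal.mul_mem_left _ _ (Ideal.subset_span (by simp)))
  · rw [Ideal.span_le]
    rintro x (rfl | rfl | rfl)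
    · exact Ideal.subset_span (by simp)
    · exact Ideal.subset_span (by simp)
    · have h1 : x - s * u ∈ Ideal.span ({y, u, x - s * u} : Set R) := Ideal.subset_span (by simp)
      have h2 : u ∈ Ideal.span ({y, u, x - s * u} : Set R) := Ideal.subset_span (by simp)
      have h := Ideal.add_mem _ h1 (Ideal.mul_mem_left _ s h2)
      rwa [sub_add_cancel] at h

/-- `(y, u, w + s u) = (y, u, w)` as ideals. [folklore] -/
private theorem span_triple_add_mul_snd_eq (y u w s : R) :
    Ideal.span ({y, u, w + s * u} : Set R) = Ideal.span {y, u, w} := by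
  rw [← sub_neg_eq_add, ← neg_mul]
  exact span_triple_sub_mul_snd_eq y u w (-s)

/-- `(y + t, u, w) = (y, u, w)` as ideals for `t = r₁ u + r₂ w`. [folklore] -/
private theorem span_triple_add_linear_eq (y u w r₁ r₂ : R) :
    Ideal.span ({y + (r₁ * u + r₂ * w), u, w} : Set R) = Ideal.span {y, u, w} := by
  have hsub : ∀ y₀ : R, r₁ * u + r₂ * w ∈ Ideal.span ({y₀, u, w} : Set R) := fun y₀ =>
    Ideal.add_mem _ (Ideal.mul_mem_left _ _ (Ideal.subset_span (by simp)))
      (Ideal.mul_mem_left _ _ (Ideal.subset_span (by simp)))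
  apply le_antisymm
  · rw [Ideal.span_le]
    rintro x (rfl | rfl | rfl)
    · exact Ideal.add_mem _ (Ideal.subset_span (by simp)) (hsub y)
    · exact Ideal.subset_span (by simp)
    · exact Ideal.subset_span (by simp)
  · rw [Ideal.span_le]
    rintro x (rfl | rfl | rfl)
    · have h1 : x + (r₁ * u + r₂ * w) ∈ Ideal.span ({x + (r₁ * u + r₂ * w), u, w} : Set R) :=
        Ideal.subset_span (by simp)
      have h := Ideal.sub_mem _ h1 (hsub (x + (r₁ * u + r₂ * w)))
      rwa [add_sub_cancel_right] at h
    · exact Ideal.subset_span (by simp)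
    · exact Ideal.subset_span (by simp)

/-- `shiftZ (y, u, w) t = (y + t, u, w)`. [folklore] -/
private theorem shiftZ_vec3 (y u w t : R) : shiftZ ![y, u, w] t = ![y + t, u, w] := by
  funext i
  fin_cases i <;> rfl

variable [IsRegularLocalRing R] (hdim : ringKrullDim R = 3) {J : Ideal R} {μ : ℕ}

include hdim in
/-- **The adapted coordinate from `τ = 1` and a monic element, on a prescribed centre.** Let
`(y, u, w)` be a regular system of parameters of `R` with `τ = 1` for every regular system,
`J ⊆ 𝔪^μ` (`0 < μ`) with a monic element w.r.t. `(y, u, w)`. Then there is `y″` with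
`(y″, u, w) = 𝔪` and `cl_μ(J) ⊆ k·Y″^μ`; if moreover (`Q`) a centre `P = (y + r₁ u + r₂ w, u)` with
`J ⊆ P^μ` is prescribed, `y″` may be taken with `(y″, u) = P`.
[cite: CossartPiltant2008, §4 p. 11] [cite: CossartJannsenSaito2020, (12.1), Claim 13.8] -/
theorem exists_adapted_coordinate_of_hasMonic (y u w : R)
    (hgen : Ideal.span {y, u, w} = maximalIdeal R) (hJμ : J ≤ maximalIdeal R ^ μ) (hμ : 0 < μ)
    (hτ : ∀ c : Fin 3 → R, Ideal.span {c 0, c 1, c 2} = maximalIdeal R → hironakaTauAt c J μ = 1)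
    (hmon : HasMonic ![y, u, w] J μ) (Q : Prop) (P : Ideal R)
    (hP : Q → ∃ r₁ r₂ : R, Ideal.span {y + (r₁ * u + r₂ * w), u} = P) (hJP : Q → J ≤ P ^ μ) :
    ∃ y'' : R, Ideal.span {y'', u, w} = maximalIdeal R ∧ (Q → Ideal.span {y'', u} = P) ∧
      ∀ G ∈ initialForms ![y'', u, w] J μ, ∃ a : ResidueField R, G = C a * X 0 ^ μ := by
  classical
  have hgenc : Ideal.span {(![y, u, w] : Fin 3 → R) 0, (![y, u, w] : Fin 3 → R) 1,
      (![y, u, w] : Fin 3 → R) 2} = maximalIdeal R := hgen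
  by_cases hQ : Q
  · obtain ⟨r₁, r₂, hPeq⟩ := hP hQ
    have hmon₁ := hasMonic_shiftZ_linear (![y, u, w]) hgenc hdim hJμ hμ (hτ _ hgenc) hmon r₁ r₂
    rw [shiftZ_vec3] at hmon₁
    set y₁ : R := y + (r₁ * u + r₂ * w) with hy₁
    have hgen₁' : Ideal.span {y₁, u, w} = maximalIdeal R := by
      rw [hy₁, span_triple_add_linear_eq]; exact hgen
    have hgen₁ : Ideal.span {(![y₁, u, w] : Fin 3 → R) 0, (![y₁, u, w] : Fin 3 → R) 1,
        (![y₁, u, w] : Fin 3 → R) 2} = maximalIdeal R := hgen₁'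
    obtain ⟨b, cc, had, hcc⟩ :=
      exists_adapted_shiftZ_of_hasMonic (![y₁, u, w]) hgen₁ hdim hJμ hμ (hτ _ hgen₁) hmon₁
    have hcc0 : cc = 0 := hcc (by
      show J ≤ Ideal.span {y₁, u} ^ μ
      rw [hPeq]; exact hJP hQ)
    rw [shiftZ_vec3, hcc0, zero_mul, add_zero] at had
    refine ⟨y₁ + b * u, ?_, fun _ => ?_, had⟩
    · have h := span_triple_add_linear_eq y₁ u w b 0
      rw [zero_mul, add_zero] at h
      rw [h]; exact hgen₁'
    · rw [← hPeq]; exact Ideal.span_pair_add_mul_right y₁ u b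
  · obtain ⟨b, cc, had, -⟩ :=
      exists_adapted_shiftZ_of_hasMonic (![y, u, w]) hgenc hdim hJμ hμ (hτ _ hgenc) hmon
    rw [shiftZ_vec3] at had
    refine ⟨y + (b * u + cc * w), ?_, fun h => absurd h hQ, had⟩
    rw [span_triple_add_linear_eq]; exact hgen

variable {R' : Type u} [CommRing R'] [IsRegularLocalRing R'] (φ : R →+* R')

include hdim in
/-- **A monic element at the next level of a chart step.** Let `(y, u, w)` be a regular system of
parameters of `R` with `cl_μ(J) ⊆ k·Y^μ`, `J ⊆ 𝔪^μ`, `J ⊄ 𝔪^{μ+1}`; let `φ : R → R′` with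
`φ y = φ u · y′`, `(y′, φ u, w′)` a regular system of parameters of `R′`, `φ(𝔪) R′ ⊆ (φ u, w′)`,
`φ(J) R′ ⊆ (φ u^μ)` and `J′ ⊆ 𝔪′^μ` containing every `g′` with `φ u^μ g′ ∈ φ(J) R′`. Then some
`in_μ(g′)`, `g′ ∈ J′`, has a `Y′^μ` term. [cite: CossartPiltant2008, (11)]
[cite: CossartJannsenSaito2020, Lemma 12.1 (2), Lemma 14.1 (2)] -/
theorem hasMonic_of_chart_step (y u w : R) (hgen : Ideal.span {y, u, w} = maximalIdeal R)
    (hJμ : J ≤ maximalIdeal R ^ μ) (hJne : ¬ J ≤ maximalIdeal R ^ (μ + 1))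
    (had : ∀ G ∈ initialForms ![y, u, w] J μ, ∃ a : ResidueField R, G = C a * X 0 ^ μ)
    (y' w' : R') (hgen' : Ideal.span {y', φ u, w'} = maximalIdeal R') (hdim' : ringKrullDim R' = 3)
    (h₀ : φ y = φ u * y') (hφ : (maximalIdeal R).map φ ≤ Ideal.span {φ u, w'})
    {J' : Ideal R'} (hJμ' : J' ≤ maximalIdeal R' ^ μ) (hJφ : J.map φ ≤ Ideal.span {φ u ^ μ})
    (hJ' : ∀ g' : R', φ u ^ μ * g' ∈ J.map φ → g' ∈ J') : HasMonic ![y', φ u, w'] J' μ := by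
  have hgenc : Ideal.span {(![y, u, w] : Fin 3 → R) 0, (![y, u, w] : Fin 3 → R) 1,
      (![y, u, w] : Fin 3 → R) 2} = maximalIdeal R := hgen
  have hgenc' : Ideal.span {(![y', φ u, w'] : Fin 3 → R') 0, (![y', φ u, w'] : Fin 3 → R') 1,
      (![y', φ u, w'] : Fin 3 → R') 2} = maximalIdeal R' := hgen'
  obtain ⟨g, hgJ, hg⟩ := SetLike.not_le_iff_exists.mp hJne
  obtain ⟨f, hf⟩ := exists_sub_mul_pow_mem_of_forall_initialForms (![y, u, w]) hgenc hdim hJμ had hgJ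
  have hy : y ∈ maximalIdeal R := hgen ▸ Ideal.subset_span (by simp)
  have hfu : IsUnit f := isUnit_of_sub_mul_pow_mem hy hg hf
  obtain ⟨g', hg'⟩ := Ideal.mem_span_singleton'.mp (hJφ (Ideal.mem_map_of_mem φ hgJ))
  have hg'J : g' ∈ J' := hJ' g' (by rw [mul_comm, hg']; exact Ideal.mem_map_of_mem φ hgJ)
  exact hasMonic_of_monic_of_chart φ (c := ![y, u, w]) (c' := ![y', φ u, w']) hgenc' hdim'
    (j := 1) (Or.inl rfl) rfl h₀ hφ hJμ' hf (hfu.map φ) (by rw [← hg', mul_comm]; rfl) hg'J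

end ChartStep

end Literature.AlgebraicGeometry.Resolution

end
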